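import Summits.QuantumFields.BalabanUV.T4Continuum.Support.NE7EJBracketSecondOrder

/-!
# NE7EJBracketWeights — row NE7 (node U5), candidate route HOM, variant H1L-EJ: LENS 2's (E4a) ∕ (E4b) ∕ (E4c) EXACTLY — the remainders of the
# quadratic junction bracket as τ-WEIGHTED INTEGRALS OF THE CURVATURE: `R₂ = ∫₀¹ (1−τ)·2q(τ,τ) dτ`, `R₂′ = ∫₀¹ τ·2q(τ,τ) dτ`, `∫₀¹ 2q = 𝔇(U_0) − 𝔇(U_1)`

Lineage `b2b-balaban-t4-ne7-p2` (CRUX PROVER NE7 #2 = C-HOM°'s kernel hand), generation 80; file 116 (sequel of 109 `NE7EJBracketPath`, 115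
`NE7EJBracketSecondOrder`).  CONSUMER SHAPE (by name): lens 2's S-91-1 (`t4/ideate/NE7/lens2-g91/ENVELOPE-SUPPLY.md` §2): «Taylor with integral
remainder at τ = 0 and τ = 1: (E4a) R₂ = 𝔇(U^A) − Br = g′(0) − (g(1) − g(0)) = ∫₀¹ (1−τ) q(τ) dτ; (E4b) R₂′ = Br − 𝔇(U^B) = ∫₀¹ τ q(τ) dτ; (E4c) R₂ + R₂′ =
∫₀¹ q = 𝔇(U^A) − 𝔇(U^B)».  With file 109's `g′ = f` (Hellmann–Feynman, `f(τ) = ⟨U_τB, E U_τB⟩`) and file 115's `f′ = −2q(τ,τ)` (both as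
`HasDerivWithinAt` on `[0,1]`), integration by parts (Mathlib's `intervalIntegral.integral_mul_deriv_eq_deriv_mul_of_hasDerivWithinAt`) gives the three
identities EXACTLY, in file 109's normalisation (curvature `2q`):
* §1 `continuousAt_qdiag ∕ continuousOn_qdiag` (the curvature `τ ↦ q(τ,τ)` is continuous on `[0,1]`), `qdiag_intervalIntegrable`, `continuousOn_defectForm`,
  `integral_curvature_eq` ((E4c): `∫₀¹ 2q(τ,τ) dτ = f(0) − f(1) = 𝔇-form(H₀B) − 𝔇-form(H₁B)`).
* §2 **`remB_eq_weighted_integral`** ((E4a): `R₂(B) = ∫₀¹ (1−τ)·2q(τ,τ) dτ`) and **`remA_eq_weighted_integral`** ((E4b): `R₂′(B) = ∫₀¹ τ·2q(τ,τ) dτ`),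
  where `R₂(B) = qf K₁ (H₀B) − qf K₁ (H₁B)`, `R₂′(B) = qf K₀ (H₁B) − qf K₀ (H₀B)` are file 106's `remB ∕ remA` of the two quadratic actions.

HONEST FRAMING: [folklore] (integration by parts on `[0,1]`); REAL forms; nothing of Bałaban's instantiated; NOT the complex-domain reading (which needs
the ‖G_w‖ bound = K1-var(s) quantitative), NOT (N1-δ), NOT EJ-1c ∕ EJ-2 ∕ EJ-3; NOT a letter move; credit (E4a–c) lens 2 g91.  NE7 NOT PRINTED ∕ NOT
PROVED; spine 0∕9; FIXED FINITE T⁴, rung (B)+1; NOT infinite volume, NOT mass gap, NOT Clay.  HONEST DEPENDENCY: continuum YM on T⁴ ⇐ BetaPertH ∧ nine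
spine estimates (0/9 proved); BetaPertH ⇐ (D1) ∧ (D4) ∧ CAP+tail; G-an2-4 gates asym, D1 and NE2/3/4.
-/

noncomputable section

open Matrix Set Filter Topology MeasureTheory intervalIntegral

namespace Summit.QuantumFields.BalabanUV.T4Continuum.NE7EJBracketWeights

open Literature.MathematicalPhysics.QuantumFieldTheory.Balaban1983to89.Beta.Composition (blockProp)
open Literature.MathematicalPhysics.QuantumFieldTheory.Balaban1983to89.Beta.Envelope
open NE7EJBracket NE7EJBracketForms NE7EJBracketPath NE7EJBracketSecondOrder

variable {ν μ : Type*} [Fintype ν] [Fintype μ] [DecidableEq ν] [DecidableEq μ]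
variable {K₀ E : Matrix ν ν ℝ} {Q : Matrix μ ν ℝ}

/-! ### §1 Continuity of the curvature and of the defect form on `[0,1]`; (E4c) -/

section Curvature

omit [DecidableEq ν] [DecidableEq μ] in
/-- a matrix function and a vector function both continuous at a point give a continuous `A σ *ᵥ v σ`. [folklore] -/
theorem continuousAt_mulVec' {l m : Type*} [Fintype l] [Fintype m] {f : ℝ → Matrix l m ℝ} {v : ℝ → m → ℝ} {τ : ℝ} (hf : ContinuousAt f τ)
    (hv : ContinuousAt v τ) : ContinuousAt (fun σ => f σ *ᵥ v σ) τ :=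
  ((continuous_fst.matrix_mulVec continuous_snd).continuousAt).comp (hf.prodMk hv)

/-- the curvature `τ ↦ q(τ,τ) = ⟨E U_τB, G_τ E U_τB⟩` is continuous at every `τ ∈ [0,1]`. [folklore] -/
theorem continuousAt_qdiag (h0 : K₀.PosDef) (h1 : (K₀ + E).PosDef) (hQ : Function.Injective Q.vecMul) (B : μ → ℝ) {τ : ℝ}
    (hτ : τ ∈ Icc (0:ℝ) 1) : ContinuousAt (fun σ => qrem K₀ E Q B σ σ) τ := by
  simp only [qrem_apply]
  have hx : ContinuousAt (fun σ => E *ᵥ lineMin K₀ E Q B σ) τ :=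
    continuousAt_mulVec' continuousAt_const (continuousAt_lineMin h0 h1 hQ B hτ)
  exact continuousAt_dotProduct' hx (continuousAt_mulVec' (continuousAt_constrProp_lineK h0 h1 hQ hτ) hx)

/-- hence continuous on `[0,1]`. [folklore] -/
theorem continuousOn_qdiag (h0 : K₀.PosDef) (h1 : (K₀ + E).PosDef) (hQ : Function.Injective Q.vecMul) (B : μ → ℝ) :
    ContinuousOn (fun σ => qrem K₀ E Q B σ σ) (Icc (0:ℝ) 1) := fun _ hτ =>
  (continuousAt_qdiag h0 h1 hQ B hτ).continuousWithinAt

/-- and interval-integrable on `[0,1]` (any continuous multiple). [folklore] -/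
theorem weighted_qdiag_intervalIntegrable (h0 : K₀.PosDef) (h1 : (K₀ + E).PosDef) (hQ : Function.Injective Q.vecMul) (B : μ → ℝ)
    {w : ℝ → ℝ} (hw : Continuous w) : IntervalIntegrable (fun σ => w σ * (2 * qrem K₀ E Q B σ σ)) volume 0 1 := by
  apply ContinuousOn.intervalIntegrable
  rw [Set.uIcc_of_le zero_le_one]
  exact hw.continuousOn.mul (continuousOn_const.mul (continuousOn_qdiag h0 h1 hQ B))

/-- the defect form `f(τ) = ⟨U_τB, E U_τB⟩` is continuous on `[0,1]`. [folklore] -/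
theorem continuousOn_defectForm (h0 : K₀.PosDef) (h1 : (K₀ + E).PosDef) (hQ : Function.Injective Q.vecMul) (B : μ → ℝ) :
    ContinuousOn (fun σ => qf E (lineMin K₀ E Q B σ)) (Icc (0:ℝ) 1) := fun _ hτ =>
  (hasDerivWithinAt_defectForm h0 h1 hQ B hτ).continuousWithinAt

/-- **(E4c)**: `∫₀¹ 2q(τ,τ) dτ = f(0) − f(1)` — the total curvature is the drop of the defect form from run A's to run B's minimiser. [folklore] -/
theorem integral_curvature_eq (h0 : K₀.PosDef) (h1 : (K₀ + E).PosDef) (hQ : Function.Injective Q.vecMul) (B : μ → ℝ) :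
    ∫ τ in (0:ℝ)..1, 2 * qrem K₀ E Q B τ τ = qf E (minMap K₀ Q *ᵥ B) - qf E (minMap (K₀ + E) Q *ᵥ B) := by
  have hderiv : ∀ x ∈ Ioo (0:ℝ) 1,
      HasDerivWithinAt (fun σ => qf E (lineMin K₀ E Q B σ)) (-(2 * qrem K₀ E Q B x x)) (Ioi x) x := fun x hx =>
    ((hasDerivWithinAt_defectForm h0 h1 hQ B ⟨hx.1.le, hx.2.le⟩).mono_of_mem_nhdsWithin
      (mem_of_superset (Icc_mem_nhdsGT hx.2) (Icc_subset_Icc_left hx.1.le)))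
  have hint : IntervalIntegrable (fun σ => -(2 * qrem K₀ E Q B σ σ)) volume 0 1 := by
    have := weighted_qdiag_intervalIntegrable h0 h1 hQ B (w := fun _ => (-1:ℝ)) continuous_const
    refine this.congr ?_
    intro σ _; ring
  have h := integral_eq_sub_of_hasDeriv_right_of_le zero_le_one (continuousOn_defectForm h0 h1 hQ B) hderiv hint
  rw [intervalIntegral.integral_neg] at h
  simp only [lineMin_apply, lineK_zero, lineK_one] at h
  linarith

end Curvature

/-! ### §2 (E4a) and (E4b): the remainders as τ-weighted integrals of the curvature -/

section Weights

/-- **(E4a) EXACTLY**: `R₂(B) = qf K₁ (H₀B) − qf K₁ (H₁B) = ∫₀¹ (1−τ)·2q(τ,τ) dτ` (integration by parts with weight `1 − τ`, `g′ = f` from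
file 109, `f′ = −2q` from file 115). [folklore] -/
theorem remB_eq_weighted_integral (h0 : K₀.PosDef) (h1 : (K₀ + E).PosDef) (hQ : Function.Injective Q.vecMul) (B : μ → ℝ) :
    remB (qf (K₀ + E)) (minMap K₀ Q *ᵥ B) (minMap (K₀ + E) Q *ᵥ B) = ∫ τ in (0:ℝ)..1, (1 - τ) * (2 * qrem K₀ E Q B τ τ) := by
  -- by parts: ∫ u v′ = u(1)v(1) − u(0)v(0) − ∫ u′ v with u = 1 − τ, v = f, v′ = −2q
  have hu : ∀ x ∈ uIcc (0:ℝ) 1, HasDerivWithinAt (fun τ : ℝ => 1 - τ) (-1) (uIcc (0:ℝ) 1) x := fun x _ =>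
    ((hasDerivAt_id x).const_sub 1 |>.hasDerivWithinAt).congr_deriv (by simp)
  have hv : ∀ x ∈ uIcc (0:ℝ) 1,
      HasDerivWithinAt (fun σ => qf E (lineMin K₀ E Q B σ)) (-(2 * qrem K₀ E Q B x x)) (uIcc (0:ℝ) 1) x := fun x hx => by
    rw [Set.uIcc_of_le zero_le_one] at hx ⊢
    exact hasDerivWithinAt_defectForm h0 h1 hQ B hx
  have hu' : IntervalIntegrable (fun _ : ℝ => (-1:ℝ)) volume 0 1 := intervalIntegrable_const
  have hv' : IntervalIntegrable (fun σ => -(2 * qrem K₀ E Q B σ σ)) volume 0 1 := by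
    have := weighted_qdiag_intervalIntegrable h0 h1 hQ B (w := fun _ => (-1:ℝ)) continuous_const
    refine this.congr ?_
    intro σ _; ring
  have hparts := intervalIntegral.integral_mul_deriv_eq_deriv_mul_of_hasDerivWithinAt hu hv hu' hv'
  -- ∫ (1−τ)(−2q) = (1−1) f(1) − (1−0) f(0) − ∫ (−1) f
  have hE1 := lineValue_one_sub_zero_eq_integral h0 h1 hQ B
  have hBr := bracket_forms_eq_sub_green h0 h1 hQ B
  rw [add_sub_cancel_left] at hBr
  have hR := remB_forms_eq_green h0 h1 hQ B
  rw [add_sub_cancel_left] at hR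
  -- assemble: R₂ = qf E (H₀B) − Br, Br = ∫ f
  have hneg : ∫ τ in (0:ℝ)..1, (1 - τ) * (2 * qrem K₀ E Q B τ τ) = -∫ τ in (0:ℝ)..1, (1 - τ) * -(2 * qrem K₀ E Q B τ τ) := by
    rw [← intervalIntegral.integral_neg]
    refine intervalIntegral.integral_congr fun τ _ => ?_
    ring
  have hf : ∫ τ in (0:ℝ)..1, (-1:ℝ) * qf E (lineMin K₀ E Q B τ) = -(∫ τ in (0:ℝ)..1, qf E (lineMin K₀ E Q B τ)) := by
    rw [← intervalIntegral.integral_neg]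
    refine intervalIntegral.integral_congr fun τ _ => ?_
    ring
  rw [hneg, hparts, hf, ← hE1, hR]
  simp only [lineMin_apply, lineK_zero, sub_self, zero_mul, sub_zero, one_mul, zero_sub]
  rw [hBr, qf_apply]
  ring

/-- **(E4b) EXACTLY**: `R₂′(B) = qf K₀ (H₁B) − qf K₀ (H₀B) = ∫₀¹ τ·2q(τ,τ) dτ` (integration by parts with weight `τ`). [folklore] -/
theorem remA_eq_weighted_integral (h0 : K₀.PosDef) (h1 : (K₀ + E).PosDef) (hQ : Function.Injective Q.vecMul) (B : μ → ℝ) :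
    remA (qf K₀) (minMap K₀ Q *ᵥ B) (minMap (K₀ + E) Q *ᵥ B) = ∫ τ in (0:ℝ)..1, τ * (2 * qrem K₀ E Q B τ τ) := by
  have hu : ∀ x ∈ uIcc (0:ℝ) 1, HasDerivWithinAt (fun τ : ℝ => τ) 1 (uIcc (0:ℝ) 1) x := fun x _ => (hasDerivAt_id x).hasDerivWithinAt
  have hv : ∀ x ∈ uIcc (0:ℝ) 1,
      HasDerivWithinAt (fun σ => qf E (lineMin K₀ E Q B σ)) (-(2 * qrem K₀ E Q B x x)) (uIcc (0:ℝ) 1) x := fun x hx => by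
    rw [Set.uIcc_of_le zero_le_one] at hx ⊢
    exact hasDerivWithinAt_defectForm h0 h1 hQ B hx
  have hu' : IntervalIntegrable (fun _ : ℝ => (1:ℝ)) volume 0 1 := intervalIntegrable_const
  have hv' : IntervalIntegrable (fun σ => -(2 * qrem K₀ E Q B σ σ)) volume 0 1 := by
    have := weighted_qdiag_intervalIntegrable h0 h1 hQ B (w := fun _ => (-1:ℝ)) continuous_const
    refine this.congr ?_
    intro σ _; ring
  have hparts := intervalIntegral.integral_mul_deriv_eq_deriv_mul_of_hasDerivWithinAt hu hv hu' hv'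
  have hE1 := lineValue_one_sub_zero_eq_integral h0 h1 hQ B
  have hBr := bracket_forms_eq_add h0 h1 hQ B
  rw [add_sub_cancel_left] at hBr
  have hneg : ∫ τ in (0:ℝ)..1, τ * (2 * qrem K₀ E Q B τ τ) = -∫ τ in (0:ℝ)..1, τ * -(2 * qrem K₀ E Q B τ τ) := by
    rw [← intervalIntegral.integral_neg]
    refine intervalIntegral.integral_congr fun τ _ => ?_
    ring
  have hf : ∫ τ in (0:ℝ)..1, (1:ℝ) * qf E (lineMin K₀ E Q B τ) = ∫ τ in (0:ℝ)..1, qf E (lineMin K₀ E Q B τ) := by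
    refine intervalIntegral.integral_congr fun τ _ => ?_
    ring
  rw [remA_forms h0 h1 hQ B, hneg, hparts, hf, ← hE1, hBr]
  simp only [lineMin_apply, lineK_one]
  ring

end Weights

end Summit.QuantumFields.BalabanUV.T4Continuum.NE7EJBracketWeights

end
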